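import Literature.NumberTheory.EllipticCurves.HeightCovolumeBounds
import Literature.NumberTheory.EllipticCurves.UniformizationProofs
import Mathlib.NumberTheory.ModularForms.LevelOne.GradedRing
import Mathlib.NumberTheory.ModularForms.EisensteinSeries.QExpansion
import Mathlib.NumberTheory.Modular
import Mathlib.MeasureTheory.Measure.Lebesgue.Complex
import Mathlib.Analysis.Complex.ExponentialBounds
import Mathlib.Analysis.Real.Pi.Bounds
import Mathlib.Analysis.SpecialFunctions.Log.Deriv
import HarnessLib

/-!
# Watkins 2004, Lemma 2.1 (`Ω · D^{1/6} ≤ 14.045`) — proof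

Discharges the named fact `Literature.NumberTheory.EllipticCurves.watkins2004_lemma_2_1` of
`Literature/NumberTheory/EllipticCurves/HeightCovolumeBounds.lean`
(`watkins2004_lemma_2_1_holds`): for every elliptic `W/ℚ` and every Mathlib `PeriodPair` `L` with
`g₂(L) = c₄(W)/12`, `g₃(L) = c₆(W)/216` (`IsNeronLatticeOf (W.baseChange ℂ) L`),
`ZLattice.covolume L.lattice * |W.Δ|^{1/6} ≤ 14.045`.

M. Watkins, *Explicit lower bounds on the modular degree of an elliptic curve*, arXiv:math/0408126
(2004), Lemma 2.1 (held; read p. 4): "Let `E` be an elliptic curve, `Ω` the area of its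
fundamental parallelogram, and `D` the absolute value of its discriminant. Then
`1/Ω ≥ D^{1/6}/14.045`." Watkins' printed proof writes the real and imaginary periods as
`π/agm(·,·)` (Cohen, *A course in computational algebraic number theory*, Ch. 7) and minimises
over the shape of the 2-torsion, separately for `Δ > 0` and `Δ < 0`; the minimum is at the
curves with `j = 0` (his `c = ±√(4/3)`), where `1/Ω = D^{1/6}/14.0445…`.

## The argument formalised here

Mathlib has neither the AGM nor the period/elliptic-integral link, so we prove the SAME statement
through its modular reformulation (the quantity `Ω D^{1/6}` is a function of the lattice shape
only):

* (A–C, the dictionary; the lemmas are copies of the private lemmas of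
  `SilvermanHeightCovolumeProofs.lean`, same tree) every period lattice is `ω(ℤτ + ℤ)` with `τ` in
  the standard fundamental domain `𝒟` of `SL(2, ℤ)`, `covol = |ω|² Im τ`
  (`ZLattice.covolume_eq_det_mul_measureReal`), and for a lattice with `g₂ = c₄/12`,
  `g₃ = c₆/216`: `Δ(W) = (c₄³ − c₆²)/1728 = (2π)¹² ω⁻¹² Δ(τ)` with `Δ(τ) = η(τ)²⁴` Mathlib's
  `ModularForm.discriminant` (`discriminant_eq_E₄_cube_sub_E₆_sq`, `ζ(4)` (Mathlib), `ζ(6)`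
  (`PeriodPair.riemannZeta_six`), `tsum_eisSummand_eq_riemannZeta_mul_eisensteinSeries`). Hence
  `covol · |Δ(W)|^{1/6} = 4π² · Im τ · |Δ(τ)|^{1/6}` and the claim is
  `(Im τ)⁶ |Δ(τ)| ≤ (14.045/4π²)⁶` for `τ ∈ 𝒟` (`im_pow_six_mul_norm_discriminant_le`, which only
  uses `Im τ ≥ √3/2`). The true maximum of `(Im τ)⁶|Δ(τ)|` over `ℍ` is at `τ = ρ = e^{2πi/3}`
  (Watkins' `j = 0` case) and gives `4π²(√3/2)|Δ(ρ)|^{1/6} = 14.04455…`, so the margin is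
  `3·10⁻⁵` (relative) in the statement and `2·10⁻⁴` in `(Im τ)⁶|Δ(τ)|`.
* (D) From `Δ = q ∏_{n≥1}(1 − qⁿ)²⁴` (`ModularForm.discriminant_eq_q_prod`), with `r = |q| =
  e^{-2π Im τ}`: `|∏(1 − qⁿ)| ≤ (1+r)²(1−r) e^{r³/(1−r)}` — the first two factors are bounded
  JOINTLY (`|(1−q)(1−q²)|² = (s−v)²(s+v) ≤ (s+2r)²(s−2r)`, `s = 1+r²`, `v = 2 Re q`; factorwise
  bounds lose more than the margin), the others by `1 + rⁿ ≤ e^{rⁿ}`; limits of partial products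
  via `Multipliable.tendsto_prod_tprod_nat`.
* (E) `48 log(1+r) + 24 log(1−r) + 24r³/(1−r) ≤ ψ(r) = 24r − 36r² + 100r³` (`r ≤ 1/25`,
  `Real.abs_log_sub_add_sum_range_le`), so `y⁶|Δ(x+iy)| ≤ exp K(y)`,
  `K(y) = 6 log y − 2πy + ψ(e^{−2πy})`.
* (F) `sup_{y ≥ a} K ≤ K(a) + ε²/(2c)` for `a = √3/2`, from `K'' ≤ −c = −15/8` on `[a, 1]`,
  `K'(a) ≤ ε = 1/300` (in truth `K'(a) ≈ −1.4·10⁻⁵`: `ρ` is an exact critical point, being an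
  elliptic point) and `K' ≤ 6 − 2π < 0` on `[1, ∞)`; twice `antitoneOn_of_deriv_nonpos`.
* (G) numerics with `Real.pi_gt_d6/pi_lt_d6`, `Real.exp_one_gt_d9/lt_d9`, `Real.exp_bound'`,
  `Real.sum_le_exp_of_nonneg`: `0.004317 ≤ e^{−π√3} ≤ 0.0043336`, and finally
  `(27/64) · 0.0043336 · e^{0.10335} ≤ (14.045/(4·3.141593²))⁶` by `norm_num`.

## References

* [Watkins2004] M. Watkins, *Explicit lower bounds on the modular degree of an elliptic curve*,
  arXiv:math/0408126 (2004), Lemma 2.1.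
* J. H. Silverman, *The Arithmetic of Elliptic Curves*, GTM 106, VI.3.6 (uniformisation
  identities `g₂ = 60G₄`, `g₃ = 140G₆`); F. Diamond, J. Shurman, *A First Course in Modular
  Forms*, §1.2 (`Δ = (2π)¹² η²⁴`, the product formula).
-/

noncomputable section

open _root_.Complex _root_.UpperHalfPlane _root_.EisensteinSeries _root_.ModularForm
open scoped MatrixGroups Real Topology

namespace Literature.NumberTheory.EllipticCurves

namespace Watkins2004

open Literature.NumberTheory.EllipticCurves.ModularForms

/-! ### A. Lattice sums of a period pair as level-one Eisenstein sums
(verbatim from the private lemmas of `SilvermanHeightCovolumeProofs.lean`) -/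

/-- `G_k(γ • τ) = (cτ + d)^k G_k(τ)` for the full lattice sum. [folklore] -/
lemma tsum_eisSummand_smul (k : ℤ) (γ : SL(2, ℤ)) (τ : ℍ) :
    ∑' v : Fin 2 → ℤ, eisSummand k v (γ • τ) =
      denom γ τ ^ k * ∑' v : Fin 2 → ℤ, eisSummand k v τ := by
  simp_rw [eisSummand_SL2_apply, tsum_mul_left]
  congr 1
  exact (⟨fun v => Matrix.vecMul v (γ : Matrix (Fin 2) (Fin 2) ℤ),
    fun v => Matrix.vecMul v ((γ⁻¹ : SL(2, ℤ)) : Matrix (Fin 2) (Fin 2) ℤ),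
    fun v => by
      simp_rw [Matrix.vecMul_vecMul, ← Matrix.SpecialLinearGroup.coe_mul, mul_inv_cancel,
        Matrix.SpecialLinearGroup.coe_one, Matrix.vecMul_one],
    fun v => by
      simp_rw [Matrix.vecMul_vecMul, ← Matrix.SpecialLinearGroup.coe_mul, inv_mul_cancel,
        Matrix.SpecialLinearGroup.coe_one, Matrix.vecMul_one]⟩ : (Fin 2 → ℤ) ≃ (Fin 2 → ℤ)).tsum_eq
    (fun v => eisSummand k v τ)

/-- The first period of a period pair is nonzero. [folklore] -/
lemma periodPair_ω₁_ne_zero (L : PeriodPair) : L.ω₁ ≠ 0 := by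
  have := L.indep.ne_zero 0
  simpa using this

/-- The period ratio `ω₂/ω₁` of a period pair is not real. [folklore] -/
lemma periodPair_im_div_ne_zero (L : PeriodPair) : (L.ω₂ / L.ω₁).im ≠ 0 := by
  intro h
  have h1 : L.ω₂ = ((L.ω₂ / L.ω₁).re : ℂ) * L.ω₁ := by
    have : L.ω₂ / L.ω₁ = ((L.ω₂ / L.ω₁).re : ℂ) := by
      apply Complex.ext <;> simp [h]
    rw [← this, div_mul_cancel₀ _ (periodPair_ω₁_ne_zero L)]
  have h2 := LinearIndependent.pair_iff.mp L.indep ((L.ω₂ / L.ω₁).re) (-1) (by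
    simp only [Complex.real_smul]
    rw [← h1]; push_cast; ring)
  simpa using h2.2

/-- The lattice sums of `L` in terms of `τ = s ω₂/ω₁ ∈ ℍ` (`s = ±1`). [folklore] -/
lemma periodPair_G_eq_tsum (L : PeriodPair) (s : ℤˣ) (τ : ℍ)
    (hτ : (τ : ℂ) = (s : ℤ) * (L.ω₂ / L.ω₁)) (k : ℕ) :
    L.G k = (L.ω₁ ^ k)⁻¹ * ∑' v : Fin 2 → ℤ, eisSummand k v τ := by
  let e : (Fin 2 → ℤ) ≃ L.lattice := (finTwoArrowEquiv ℤ).trans <| (Equiv.prodComm ℤ ℤ).trans <|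
    ((Equiv.refl ℤ).prodCongr s.mulLeft).trans L.latticeEquivProd.symm.toEquiv
  have he : ∀ v, ((e v : L.lattice) : ℂ) = v 1 * L.ω₁ + ((s : ℤ) * v 0 : ℤ) * L.ω₂ := fun v => by
    simp [e, PeriodPair.latticeEquiv_symm_apply]
  rw [PeriodPair.G, ← e.tsum_eq, ← tsum_mul_left]
  congr 1 with v
  rw [he, eisSummand, zpow_neg, zpow_natCast, ← mul_inv, ← mul_pow]
  congr 2
  rw [hτ]
  have h1 := periodPair_ω₁_ne_zero L
  field_simp
  push_cast
  ring

/-- First reduction: a period pair has `τ₀ = ±ω₂/ω₁ ∈ ℍ` with `G_k(L) = ω₁^{-k} G_k(τ₀)` and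
`Im τ₀ = |Im(ω₂/ω₁)|`. [folklore] -/
lemma periodPair_exists_tau (L : PeriodPair) : ∃ τ : ℍ,
    (∀ k : ℕ, L.G k = (L.ω₁ ^ k)⁻¹ * ∑' v : Fin 2 → ℤ, eisSummand k v τ) ∧
      τ.im = |(L.ω₂ / L.ω₁).im| := by
  rcases lt_or_gt_of_ne (periodPair_im_div_ne_zero L) with h | h
  · refine ⟨UpperHalfPlane.mk (-(L.ω₂ / L.ω₁)) (by simpa using h), fun k => ?_, ?_⟩
    · refine periodPair_G_eq_tsum L (-1) _ ?_ k
      simp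
    · simp [abs_of_neg h]
  · refine ⟨UpperHalfPlane.mk (L.ω₂ / L.ω₁) h, fun k => ?_, ?_⟩
    · refine periodPair_G_eq_tsum L 1 _ ?_ k
      simp
    · simp [abs_of_pos h]

/-- Second reduction: move `τ` into the standard fundamental domain `𝒟`. [folklore] -/
lemma periodPair_exists_omega_tau_fd (L : PeriodPair) : ∃ (ω : ℂ) (τ : ℍ),
    ω ≠ 0 ∧ τ ∈ ModularGroup.fd ∧
    (∀ k : ℕ, L.G k = (ω ^ k)⁻¹ * ∑' v : Fin 2 → ℤ, eisSummand k v τ) ∧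
      ‖ω‖ ^ 2 * τ.im = ‖L.ω₁‖ ^ 2 * |(L.ω₂ / L.ω₁).im| := by
  obtain ⟨τ₀, hG, him⟩ := periodPair_exists_tau L
  obtain ⟨g, hg⟩ := ModularGroup.exists_smul_mem_fd τ₀
  refine ⟨L.ω₁ * denom g τ₀, g • τ₀, mul_ne_zero (periodPair_ω₁_ne_zero L) (denom_ne_zero g τ₀),
    hg, fun k => ?_, ?_⟩
  · rw [hG k, tsum_eisSummand_smul, mul_pow, mul_inv, mul_assoc, zpow_natCast,
      inv_mul_cancel_left₀ (pow_ne_zero _ (denom_ne_zero g τ₀))]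
  · rw [ModularGroup.im_smul_eq_div_normSq, Complex.normSq_eq_norm_sq, norm_mul, him]
    have := norm_pos_iff.mpr (denom_ne_zero g τ₀)
    field_simp

/-! ### B. The covolume of the period lattice (verbatim copy) -/

/-- The fundamental domain of the basis `(1, i)` of `ℂ` has Lebesgue measure `1`. [folklore] -/
lemma volume_real_fundamentalDomain_basisOneI :
    (MeasureTheory.volume : MeasureTheory.Measure ℂ).real
      (ZSpan.fundamentalDomain Complex.basisOneI) = 1 := by
  rw [MeasureTheory.measureReal_congr
      (ZSpan.fundamentalDomain_ae_parallelepiped Complex.basisOneI MeasureTheory.volume),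
    ← Complex.toBasis_orthonormalBasisOneI, OrthonormalBasis.coe_toBasis,
    MeasureTheory.measureReal_def, Complex.orthonormalBasisOneI.volume_parallelepiped,
    ENNReal.toReal_one]

/-- `covol(ℤω₁ + ℤω₂) = |ω₁|² |Im(ω₂/ω₁)|`. [folklore] -/
lemma periodPair_covolume (L : PeriodPair) :
    ZLattice.covolume L.lattice = ‖L.ω₁‖ ^ 2 * |(L.ω₂ / L.ω₁).im| := by
  rw [ZLattice.covolume_eq_det_mul_measureReal (L := L.lattice) (μ := MeasureTheory.volume)
      (b := L.latticeBasis) (b₀ := Complex.basisOneI),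
    volume_real_fundamentalDomain_basisOneI, mul_one, Module.Basis.det_apply, Matrix.det_fin_two]
  simp only [Module.Basis.toMatrix_apply, Function.comp_apply, PeriodPair.latticeBasis_zero,
    PeriodPair.latticeBasis_one, Complex.coe_basisOneI_repr, Matrix.cons_val_zero,
    Matrix.cons_val_one]
  have h1 := periodPair_ω₁_ne_zero L
  have key : L.ω₁.re * L.ω₂.im - L.ω₂.re * L.ω₁.im = ‖L.ω₁‖ ^ 2 * (L.ω₂ / L.ω₁).im := by
    rw [Complex.div_im, ← Complex.normSq_eq_norm_sq]
    have : Complex.normSq L.ω₁ ≠ 0 := by simpa using h1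
    field_simp
  rw [key, abs_mul, abs_of_nonneg (by positivity)]

/-- Every period lattice is `ω(ℤτ + ℤ)` with `τ ∈ 𝒟`: `G_k(L) = ω^{-k} G_k(τ)` and
`covol(L) = |ω|² Im τ`. [folklore] -/
lemma periodPair_reduction (L : PeriodPair) : ∃ (ω : ℂ) (τ : ℍ),
    ω ≠ 0 ∧ τ ∈ ModularGroup.fd ∧
    (∀ k : ℕ, L.G k = (ω ^ k)⁻¹ * ∑' v : Fin 2 → ℤ, eisSummand k v τ) ∧
      ZLattice.covolume L.lattice = ‖ω‖ ^ 2 * τ.im := by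
  obtain ⟨ω, τ, hω, hτ, hG, hcov⟩ := periodPair_exists_omega_tau_fd L
  exact ⟨ω, τ, hω, hτ, hG, by rw [periodPair_covolume, hcov]⟩

/-! ### C. `Δ` through the modular discriminant (verbatim copy) -/

/-- `∑_{(m,n) ≠ 0} (mτ+n)^{-k} = 2ζ(k) E_k(τ)` for `k ≥ 3`. [folklore] -/
lemma tsum_eisSummand_eq_E {k : ℕ} (hk : 3 ≤ k) (τ : ℍ) :
    ∑' v : Fin 2 → ℤ, eisSummand k v τ = 2 * riemannZeta k * E hk τ := by
  rw [tsum_eisSummand_eq_riemannZeta_mul_eisensteinSeries hk τ,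
    show E hk τ = (1 / 2 : ℂ) • eisensteinSeriesSIF (N := 1) 0 k τ from rfl,
    eisensteinSeriesSIF_apply, smul_eq_mul]
  ring

/-- `G₄(τ) = (π⁴/45) E₄(τ)`. [folklore] -/
lemma G_four_eq (τ : ℍ) :
    ∑' v : Fin 2 → ℤ, eisSummand ((4 : ℕ) : ℤ) v τ = (π : ℂ) ^ 4 / 45 * E₄ τ := by
  rw [tsum_eisSummand_eq_E (by norm_num) τ]
  norm_num [riemannZeta_four]
  left
  ring

/-- `G₆(τ) = (2π⁶/945) E₆(τ)` (`ζ(6) = π⁶/945`: `PeriodPair.riemannZeta_six` of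
`UniformizationProofs.lean`). [folklore] -/
lemma G_six_eq (τ : ℍ) :
    ∑' v : Fin 2 → ℤ, eisSummand ((6 : ℕ) : ℤ) v τ = 2 * (π : ℂ) ^ 6 / 945 * E₆ τ := by
  rw [tsum_eisSummand_eq_E (by norm_num) τ]
  norm_num [PeriodPair.riemannZeta_six]
  left
  ring

/-- For a Néron lattice written as `ω(ℤτ + ℤ)`: `Δ = (2π)¹² ω⁻¹² Δ(τ)`. [folklore] -/
lemma neron_Δ_eq {W : WeierstrassCurve ℚ} {L : PeriodPair}
    (hN : IsNeronLatticeOf (W.baseChange ℂ) L) {ω : ℂ} {τ : ℍ}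
    (hG : ∀ k : ℕ, L.G k = (ω ^ k)⁻¹ * ∑' v : Fin 2 → ℤ, eisSummand k v τ) :
    ((W.Δ : ℚ) : ℂ) = 4096 * π ^ 12 * (ω ^ 12)⁻¹ * ModularForm.discriminant τ := by
  obtain ⟨h2, h3⟩ := hN
  rw [WeierstrassCurve.baseChange, WeierstrassCurve.map_c₄, eq_ratCast] at h2
  rw [WeierstrassCurve.baseChange, WeierstrassCurve.map_c₆, eq_ratCast] at h3
  rw [PeriodPair.g₂, hG 4, G_four_eq] at h2
  rw [PeriodPair.g₃, hG 6, G_six_eq] at h3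
  have hc4 : ((W.c₄ : ℚ) : ℂ) = 16 * π ^ 4 * (ω ^ 4)⁻¹ * E₄ τ := by
    linear_combination (-12 : ℂ) * h2
  have hc6 : ((W.c₆ : ℚ) : ℂ) = 64 * π ^ 6 * (ω ^ 6)⁻¹ * E₆ τ := by
    linear_combination (-216 : ℂ) * h3
  have hrel := congrArg (fun q : ℚ => (q : ℂ)) W.c_relation
  simp only [Rat.cast_mul, Rat.cast_sub, Rat.cast_pow, Rat.cast_ofNat] at hrel
  rw [hc4, hc6] at hrel
  have hΔ := discriminant_eq_E₄_cube_sub_E₆_sq τ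
  have hω4 : (ω ^ 4)⁻¹ = (ω⁻¹) ^ 4 := by rw [inv_pow]
  have hω6 : (ω ^ 6)⁻¹ = (ω⁻¹) ^ 6 := by rw [inv_pow]
  have hω12 : (ω ^ 12)⁻¹ = (ω⁻¹) ^ 12 := by rw [inv_pow]
  rw [hω12, hΔ]
  rw [hω4, hω6] at hrel
  linear_combination hrel / 1728

/-! ### D. A sharp bound for `|∏ (1 - qⁿ)|` and `|Δ(τ)|` -/

/-- The elementary inequality behind the joint bound on the first two factors:
`(s - v)(s² - v²) ≤ (s + 2r)²(s - 2r)` for `s = 1 + r²`, `v = 2a ∈ [-2r, 2r]`, `r ≤ 1/7`.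
[folklore] -/
lemma poly_bound (a r : ℝ) (hr0 : 0 ≤ r) (hr : r ≤ 1 / 7) (ha : -r ≤ a) (ha' : a ≤ r) :
    (1 + r ^ 2 - 2 * a) * ((1 + r ^ 2) ^ 2 - 4 * a ^ 2) ≤ ((1 + r) ^ 2 * (1 - r)) ^ 2 := by
  have hQ : 0 ≤ -(2 * a) ^ 2 + (1 + r ^ 2 + 2 * r) * (2 * a) + (1 + r ^ 2) ^ 2
      - 2 * r * (1 + r ^ 2) - 4 * r ^ 2 := by
    nlinarith [mul_nonneg (by linarith : 0 ≤ 2 * a + 2 * r) (by linarith : 0 ≤ 2 * r - 2 * a),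
      mul_nonneg (by positivity : 0 ≤ 1 + r ^ 2 + 2 * r) (by linarith : 0 ≤ 2 * a + 2 * r),
      mul_nonneg hr0 hr0, mul_nonneg (mul_nonneg hr0 hr0) hr0, pow_le_pow_left₀ hr0 hr 2,
      pow_le_pow_left₀ hr0 hr 3, pow_le_pow_left₀ hr0 hr 4]
  nlinarith [mul_nonneg (by linarith : 0 ≤ 2 * a + 2 * r) hQ]

/-- Joint bound on the first two factors of the `q`-product: for `|q| ≤ 1/7`,
`|(1 - q)(1 - q²)| ≤ (1 + |q|)² (1 - |q|)` (equality iff `q ≤ 0`). [folklore] -/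
lemma norm_one_sub_mul_one_sub_sq_le (q : ℂ) (hq : ‖q‖ ≤ 1 / 7) :
    ‖(1 - q) * (1 - q ^ 2)‖ ≤ (1 + ‖q‖) ^ 2 * (1 - ‖q‖) := by
  have hr0 : 0 ≤ ‖q‖ := norm_nonneg q
  have hR : 0 ≤ (1 + ‖q‖) ^ 2 * (1 - ‖q‖) := by
    apply mul_nonneg (by positivity); linarith
  refine (sq_le_sq₀ (norm_nonneg _) hR).mp ?_
  set r := ‖q‖ with hr
  have hr2 : r ^ 2 = q.re ^ 2 + q.im ^ 2 := by
    rw [hr, Complex.sq_norm, Complex.normSq_apply]; ring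
  have hre : -r ≤ q.re ∧ q.re ≤ r := by
    refine abs_le.mp ?_
    rw [hr]; exact Complex.abs_re_le_norm q
  have h1 : ‖(1 - q) * (1 - q ^ 2)‖ ^ 2 =
      (1 + r ^ 2 - 2 * q.re) * ((1 + r ^ 2) ^ 2 - 4 * q.re ^ 2) := by
    rw [Complex.sq_norm, map_mul, Complex.normSq_apply, Complex.normSq_apply]
    simp only [Complex.sub_re, Complex.one_re, Complex.sub_im, Complex.one_im, sq, Complex.mul_re,
      Complex.mul_im]
    have him : q.im * q.im = r * r - q.re * q.re := by nlinarith [hr2]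
    -- eliminate `q.im²`
    have e1 : (1 - q.re) * (1 - q.re) + (0 - q.im) * (0 - q.im) = 1 + r * r - 2 * q.re := by
      nlinarith [him]
    have e2 : (1 - (q.re * q.re - q.im * q.im)) * (1 - (q.re * q.re - q.im * q.im)) +
        (0 - (q.re * q.im + q.im * q.re)) * (0 - (q.re * q.im + q.im * q.re)) =
        (1 + r * r) * (1 + r * r) - 4 * (q.re * q.re) := by
      have : (0 - (q.re * q.im + q.im * q.re)) * (0 - (q.re * q.im + q.im * q.re)) =
          4 * (q.re * q.re) * (q.im * q.im) := by ring
      rw [this, him]; ring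
    rw [e1, e2]
  rw [h1]
  exact poly_bound q.re r hr0 hq hre.1 hre.2

/-- Tail factors: `|∏_{i<m} (1 - q^{i+3})| ≤ exp(|q|³/(1-|q|))`. [folklore] -/
lemma norm_prod_tail_le (q : ℂ) (hq : ‖q‖ < 1) (m : ℕ) :
    ‖∏ i ∈ Finset.range m, (1 - q ^ (i + 3))‖ ≤ Real.exp (‖q‖ ^ 3 / (1 - ‖q‖)) := by
  have hr0 : 0 ≤ ‖q‖ := norm_nonneg q
  calc ‖∏ i ∈ Finset.range m, (1 - q ^ (i + 3))‖
      ≤ ∏ i ∈ Finset.range m, ‖1 - q ^ (i + 3)‖ := Finset.norm_prod_le _ _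
    _ ≤ ∏ i ∈ Finset.range m, (1 + ‖q‖ ^ (i + 3)) := by
        refine Finset.prod_le_prod (fun i _ => norm_nonneg _) fun i _ => ?_
        calc ‖1 - q ^ (i + 3)‖ ≤ ‖(1 : ℂ)‖ + ‖q ^ (i + 3)‖ := norm_sub_le _ _
          _ = 1 + ‖q‖ ^ (i + 3) := by rw [norm_one, norm_pow]
    _ ≤ Real.exp (∑ i ∈ Finset.range m, ‖q‖ ^ (i + 3)) :=
        Real.prod_one_add_le_exp_sum _ (fun i => by positivity)
    _ ≤ Real.exp (‖q‖ ^ 3 / (1 - ‖q‖)) := by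
        rw [Real.exp_le_exp]
        have hgeom : ∑ i ∈ Finset.range m, ‖q‖ ^ i ≤ (1 - ‖q‖)⁻¹ := by
          rw [← tsum_geometric_of_lt_one hr0 hq]
          exact Summable.sum_le_tsum _ (fun i _ => by positivity)
            (summable_geometric_of_lt_one hr0 hq)
        calc ∑ i ∈ Finset.range m, ‖q‖ ^ (i + 3) = ‖q‖ ^ 3 * ∑ i ∈ Finset.range m, ‖q‖ ^ i := by
              rw [Finset.mul_sum]; congr 1 with i; ring
          _ ≤ ‖q‖ ^ 3 * (1 - ‖q‖)⁻¹ := by gcongr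
          _ = ‖q‖ ^ 3 / (1 - ‖q‖) := by rw [div_eq_mul_inv]

/-- The sharp product bound: for `|q| ≤ 1/7`,
`|∏_{n ≥ 1} (1 - qⁿ)| ≤ (1 + |q|)²(1 - |q|) · exp(|q|³/(1 - |q|))`. [folklore] -/
lemma norm_tprod_one_sub_pow_le (q : ℂ) (hq : ‖q‖ ≤ 1 / 7) :
    ‖∏' n : ℕ, (1 - q ^ (n + 1))‖ ≤
      (1 + ‖q‖) ^ 2 * (1 - ‖q‖) * Real.exp (‖q‖ ^ 3 / (1 - ‖q‖)) := by
  have hq1 : ‖q‖ < 1 := hq.trans_lt (by norm_num)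
  have hmult : Multipliable fun n : ℕ => 1 - q ^ (n + 1) := multipliable_one_sub_pow hq1
  have hlim := (continuous_norm.tendsto _).comp hmult.tendsto_prod_tprod_nat
  refine le_of_tendsto hlim ?_
  rw [Filter.eventually_atTop]
  refine ⟨2, fun n hn => ?_⟩
  obtain ⟨m, rfl⟩ := Nat.exists_eq_add_of_le' hn
  simp only [Function.comp_apply]
  rw [Finset.prod_range_succ', Finset.prod_range_succ']
  simp only [zero_add, Nat.reduceAdd, pow_one]
  have hsplit : (∏ i ∈ Finset.range m, (1 - q ^ (i + 1 + 1 + 1))) * (1 - q ^ 2) * (1 - q) =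
      ((1 - q) * (1 - q ^ 2)) * ∏ i ∈ Finset.range m, (1 - q ^ (i + 3)) := by
    ring_nf
  rw [hsplit, norm_mul]
  have h1 := norm_one_sub_mul_one_sub_sq_le q hq
  have h2 := norm_prod_tail_le q hq1 m
  have hR : 0 ≤ (1 + ‖q‖) ^ 2 * (1 - ‖q‖) := by
    apply mul_nonneg (by positivity); linarith
  calc ‖(1 - q) * (1 - q ^ 2)‖ * ‖∏ i ∈ Finset.range m, (1 - q ^ (i + 3))‖
      ≤ (1 + ‖q‖) ^ 2 * (1 - ‖q‖) * Real.exp (‖q‖ ^ 3 / (1 - ‖q‖)) :=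
        mul_le_mul h1 h2 (norm_nonneg _) hR

/-- `|q_τ| = e^{-2π Im τ}`. [folklore] -/
lemma norm_qParam_one (τ : ℍ) :
    ‖Function.Periodic.qParam 1 (τ : ℂ)‖ = Real.exp (-2 * π * τ.im) := by
  rw [Function.Periodic.norm_qParam, div_one, UpperHalfPlane.coe_im]

/-- The discriminant bound: with `r = e^{-2π Im τ} ≤ 1/7`,
`|Δ(τ)| ≤ r · ((1+r)²(1-r))²⁴ · exp(24 r³/(1-r))`. [folklore] -/
lemma norm_discriminant_le (τ : ℍ) (hr : Real.exp (-2 * π * τ.im) ≤ 1 / 7) :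
    ‖ModularForm.discriminant τ‖ ≤ Real.exp (-2 * π * τ.im) *
      (((1 + Real.exp (-2 * π * τ.im)) ^ 2 * (1 - Real.exp (-2 * π * τ.im))) ^ 24 *
        Real.exp (24 * (Real.exp (-2 * π * τ.im) ^ 3 / (1 - Real.exp (-2 * π * τ.im))))) := by
  set q : ℂ := Function.Periodic.qParam 1 (τ : ℂ) with hqdef
  have hqn : ‖q‖ = Real.exp (-2 * π * τ.im) := norm_qParam_one τ
  have hq7 : ‖q‖ ≤ 1 / 7 := hqn ▸ hr
  have hq1 : ‖q‖ < 1 := hq7.trans_lt (by norm_num)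
  have hmult : Multipliable fun n : ℕ => 1 - q ^ (n + 1) := multipliable_one_sub_pow hq1
  have hprod : ∏' n : ℕ, (1 - eta_q n τ) ^ 24 = (∏' n : ℕ, (1 - q ^ (n + 1))) ^ 24 := by
    rw [← hmult.tprod_pow]
  rw [discriminant_eq_q_prod, hprod, norm_mul, norm_pow, ← hqdef, hqn]
  have h := norm_tprod_one_sub_pow_le q hq7
  rw [hqn] at h
  have h0 : 0 ≤ ‖∏' n : ℕ, (1 - q ^ (n + 1))‖ := norm_nonneg _
  gcongr
  calc ‖∏' n : ℕ, (1 - q ^ (n + 1))‖ ^ 24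
      ≤ ((1 + Real.exp (-2 * π * τ.im)) ^ 2 * (1 - Real.exp (-2 * π * τ.im)) *
          Real.exp (Real.exp (-2 * π * τ.im) ^ 3 / (1 - Real.exp (-2 * π * τ.im)))) ^ 24 :=
        pow_le_pow_left₀ h0 h 24
    _ = _ := by rw [mul_pow, ← Real.exp_nat_mul]; push_cast; ring_nf


/-! ### E. The logarithmic form of the bound -/

/-- `48 log(1+r) + 24 log(1-r) + 24 r³/(1-r) ≤ 24 r - 36 r² + 100 r³` for `0 ≤ r ≤ 1/25`
(Taylor expansion of `log` to second order with remainder `r³/(1-r)`). [folklore] -/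
lemma log_bound (r : ℝ) (hr0 : 0 ≤ r) (hr : r ≤ 1 / 25) :
    48 * Real.log (1 + r) + 24 * Real.log (1 - r) + 24 * (r ^ 3 / (1 - r)) ≤
      24 * r - 36 * r ^ 2 + 100 * r ^ 3 := by
  have habs : |r| < 1 := by rw [abs_of_nonneg hr0]; linarith
  have habs' : |-r| < 1 := by rw [abs_neg]; exact habs
  have h1 := Real.abs_log_sub_add_sum_range_le habs' 2
  have h2 := Real.abs_log_sub_add_sum_range_le habs 2
  rw [abs_neg, abs_of_nonneg hr0, sub_neg_eq_add] at h1
  rw [abs_of_nonneg hr0] at h2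
  simp only [Finset.sum_range_succ, Finset.range_one, Finset.sum_singleton] at h1 h2
  norm_num at h1 h2
  have h1' := (abs_le.mp h1).2
  have h2' := (abs_le.mp h2).2
  have h3 : r ^ 3 / (1 - r) ≤ 25 / 24 * r ^ 3 := by
    rw [div_le_iff₀ (by linarith)]
    nlinarith [pow_nonneg hr0 3]
  nlinarith [h1', h2', h3]

/-- `d/dy e^{-2πy} = -2π e^{-2πy}`. [folklore] -/
lemma hasDerivAt_exp_neg_two_pi_mul (y : ℝ) :
    HasDerivAt (fun y => Real.exp (-2 * π * y)) (-2 * π * Real.exp (-2 * π * y)) y := by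
  have h := ((hasDerivAt_id y).const_mul (-2 * π)).exp
  refine (h.congr_of_eventuallyEq (Filter.Eventually.of_forall fun x => ?_)).congr_deriv ?_
  · simp only [id_eq]
  · simp only [id_eq, mul_one]; ring

/-- `ψ' = 24 - 72 r + 300 r²` for `ψ(r) = 24 r - 36 r² + 100 r³`. [folklore] -/
lemma hasDerivAt_psi (r : ℝ) :
    HasDerivAt (fun r => 24 * r - 36 * r ^ 2 + 100 * r ^ 3) (24 - 72 * r + 300 * r ^ 2) r := by
  have h := (((hasDerivAt_id r).const_mul 24).sub ((hasDerivAt_pow 2 r).const_mul 36)).add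
    ((hasDerivAt_pow 3 r).const_mul 100)
  refine (h.congr_of_eventuallyEq (Filter.Eventually.of_forall fun x => ?_)).congr_deriv ?_
  · simp only [Pi.add_apply, Pi.sub_apply, id_eq]
  · norm_num; ring

/-- `Φ' = 24 - 144 r + 900 r²` for `Φ(r) = r ψ'(r) = 24 r - 72 r² + 300 r³`. [folklore] -/
lemma hasDerivAt_phi (r : ℝ) :
    HasDerivAt (fun r => 24 * r - 72 * r ^ 2 + 300 * r ^ 3) (24 - 144 * r + 900 * r ^ 2) r := by
  have h := (((hasDerivAt_id r).const_mul 24).sub ((hasDerivAt_pow 2 r).const_mul 72)).add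
    ((hasDerivAt_pow 3 r).const_mul 300)
  refine (h.congr_of_eventuallyEq (Filter.Eventually.of_forall fun x => ?_)).congr_deriv ?_
  · simp only [Pi.add_apply, Pi.sub_apply, id_eq]
  · norm_num; ring

/-- Chain rule for `K(y) = 6 log y - 2πy + ψ(e^{-2πy})` (`y > 0`). [folklore] -/
lemma hasDerivAt_log_lin_comp {ψ : ℝ → ℝ} {ψ' y : ℝ} (hy : 0 < y)
    (hψ : HasDerivAt ψ ψ' (Real.exp (-2 * π * y))) :
    HasDerivAt (fun y => 6 * Real.log y - 2 * π * y + ψ (Real.exp (-2 * π * y)))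
      (6 * y⁻¹ - 2 * π + ψ' * (-2 * π * Real.exp (-2 * π * y))) y := by
  have h1 := (Real.hasDerivAt_log hy.ne').const_mul 6
  have h2 := (hasDerivAt_id y).const_mul (2 * π)
  have h3 := hψ.comp y (hasDerivAt_exp_neg_two_pi_mul y)
  have h := (h1.sub h2).add h3
  refine (h.congr_of_eventuallyEq (Filter.Eventually.of_forall fun x => ?_)).congr_deriv ?_
  · simp only [Pi.add_apply, Pi.sub_apply, Function.comp_apply, id_eq]
  · simp only [mul_one]

/-- Chain rule for `K'(y) = 6/y - 2π - 2π Φ(e^{-2πy})` (`y > 0`). [folklore] -/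
lemma hasDerivAt_inv_sub_comp {Φ : ℝ → ℝ} {Φ' y : ℝ} (hy : 0 < y)
    (hΦ : HasDerivAt Φ Φ' (Real.exp (-2 * π * y))) :
    HasDerivAt (fun y => 6 * y⁻¹ - 2 * π - 2 * π * Φ (Real.exp (-2 * π * y)))
      (-(6 * (y ^ 2)⁻¹) + 4 * π ^ 2 * Real.exp (-2 * π * y) * Φ') y := by
  have h1 := (hasDerivAt_inv hy.ne').const_mul 6
  have h3 := (hΦ.comp y (hasDerivAt_exp_neg_two_pi_mul y)).const_mul (2 * π)
  have h := (h1.sub (hasDerivAt_const y (2 * π))).sub h3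
  refine (h.congr_of_eventuallyEq (Filter.Eventually.of_forall fun x => ?_)).congr_deriv ?_
  · simp only [Pi.sub_apply, Function.comp_apply]
  · ring

/-! ### F. The supremum of `K` on `[a, ∞)` -/

/-- Abstract second-order maximum estimate: if `K' = K₁`, `K₁' = K₂` on `(0, ∞)`,
`K₂ ≤ -c` on `[a, 1]`, `K₁(a) ≤ ε` and `K₁ ≤ 0` on `[1, ∞)`, then `K ≤ K(a) + ε²/(2c)` on
`[a, ∞)`. [folklore] -/
lemma le_add_sq_div_of_deriv2 {K K₁ K₂ : ℝ → ℝ} {a c ε : ℝ} (ha0 : 0 < a) (ha1 : a ≤ 1)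
    (hc : 0 < c) (hK : ∀ y, 0 < y → HasDerivAt K (K₁ y) y)
    (hK' : ∀ y, 0 < y → HasDerivAt K₁ (K₂ y) y)
    (hK₂ : ∀ y ∈ Set.Icc a 1, K₂ y ≤ -c) (hK₁a : K₁ a ≤ ε)
    (hK₁ : ∀ y, 1 ≤ y → K₁ y ≤ 0) {y : ℝ} (hy : a ≤ y) :
    K y ≤ K a + ε ^ 2 / (2 * c) := by
  have hpos : ∀ x ∈ Set.Icc a 1, 0 < x := fun x hx => ha0.trans_le hx.1
  -- Step 1: `K₁ y + c y` is antitone on `[a, 1]`.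
  have hdg : ∀ x, 0 < x → HasDerivAt (fun y => K₁ y + c * y) (K₂ x + c) x := by
    intro x hx
    have h := (hK' x hx).add ((hasDerivAt_id x).const_mul c)
    refine (h.congr_of_eventuallyEq (Filter.Eventually.of_forall fun z => ?_)).congr_deriv ?_
    · simp only [Pi.add_apply, id_eq]
    · simp only [mul_one]
  have hg : AntitoneOn (fun y => K₁ y + c * y) (Set.Icc a 1) := by
    refine antitoneOn_of_deriv_nonpos (convex_Icc a 1) ?_ ?_ ?_
    · exact fun x hx => (hdg x (hpos x hx)).continuousAt.continuousWithinAt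
    · intro x hx
      rw [interior_Icc] at hx
      exact (hdg x (ha0.trans hx.1)).differentiableAt.differentiableWithinAt
    · intro x hx
      rw [interior_Icc] at hx
      rw [(hdg x (ha0.trans hx.1)).deriv]
      have := hK₂ x ⟨hx.1.le, hx.2.le⟩
      linarith
  -- Step 2: `φ y = K y - ε y + c/2 (y - a)²` is antitone on `[a, 1]`.
  have hd : ∀ x, 0 < x → HasDerivAt (fun y => K y - ε * y + c / 2 * (y - a) ^ 2)
      (K₁ x - ε + c * (x - a)) x := by
    intro x hx
    have h := ((hK x hx).sub ((hasDerivAt_id x).const_mul ε)).add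
      (((hasDerivAt_id x).sub_const a).pow 2 |>.const_mul (c / 2))
    refine (h.congr_of_eventuallyEq (Filter.Eventually.of_forall fun z => ?_)).congr_deriv ?_
    · simp only [Pi.add_apply, Pi.sub_apply, Pi.pow_apply, id_eq]
    · norm_num; ring
  have hφ : AntitoneOn (fun y => K y - ε * y + c / 2 * (y - a) ^ 2) (Set.Icc a 1) := by
    refine antitoneOn_of_deriv_nonpos (convex_Icc a 1) ?_ ?_ ?_
    · exact fun x hx => (hd x (hpos x hx)).continuousAt.continuousWithinAt
    · intro x hx
      rw [interior_Icc] at hx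
      exact (hd x (ha0.trans hx.1)).differentiableAt.differentiableWithinAt
    · intro x hx
      rw [interior_Icc] at hx
      rw [(hd x (ha0.trans hx.1)).deriv]
      have h1 := hg ⟨le_rfl, ha1⟩ ⟨hx.1.le, hx.2.le⟩ hx.1.le
      simp only at h1
      linarith
  -- Step 3: the bound on `[a, 1]`.
  have hIcc : ∀ z ∈ Set.Icc a 1, K z ≤ K a + ε ^ 2 / (2 * c) := by
    intro z hz
    have h1 := hφ ⟨le_rfl, ha1⟩ hz hz.1
    simp only [sub_self, zero_pow two_ne_zero, mul_zero, add_zero] at h1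
    have h2 : ε * (z - a) - c / 2 * (z - a) ^ 2 ≤ ε ^ 2 / (2 * c) := by
      have key : ε ^ 2 / (2 * c) - (ε * (z - a) - c / 2 * (z - a) ^ 2) =
          c / 2 * ((z - a) - ε / c) ^ 2 := by
        field_simp
        ring
      have : 0 ≤ c / 2 * ((z - a) - ε / c) ^ 2 := by positivity
      linarith
    linarith
  -- Step 4: `K` is antitone on `[1, ∞)`.
  have hK1 : AntitoneOn K (Set.Ici 1) := by
    refine antitoneOn_of_deriv_nonpos (convex_Ici 1) ?_ ?_ ?_
    · exact fun x hx => (hK x (one_pos.trans_le hx)).continuousAt.continuousWithinAt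
    · intro x hx
      rw [interior_Ici] at hx
      exact (hK x (one_pos.trans hx)).differentiableAt.differentiableWithinAt
    · intro x hx
      rw [interior_Ici] at hx
      rw [(hK x (one_pos.trans hx)).deriv]
      exact hK₁ x hx.le
  rcases le_or_gt y 1 with h | h
  · exact hIcc y ⟨hy, h⟩
  · exact (hK1 (Set.mem_Ici.mpr le_rfl) (Set.mem_Ici.mpr h.le) h.le).trans (hIcc 1 ⟨ha1, le_rfl⟩)

/-- `K' ≤ 0` on `[1, ∞)`: `6/y - 2π - 2πΦ(r) ≤ 6 - 2π < 0` for `y ≥ 1`, `r ≥ 0`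
(`Φ(r) = r (300 (r - 3/25)² + 492/25) ≥ 0`). [folklore] -/
lemma six_div_sub_le_zero {y r : ℝ} (hy : 1 ≤ y) (hr : 0 ≤ r) :
    6 * y⁻¹ - 2 * π - 2 * π * (24 * r - 72 * r ^ 2 + 300 * r ^ 3) ≤ 0 := by
  have hΦ : 0 ≤ 24 * r - 72 * r ^ 2 + 300 * r ^ 3 := by
    have : 24 * r - 72 * r ^ 2 + 300 * r ^ 3 = r * (300 * (r - 3 / 25) ^ 2 + 492 / 25) := by ring
    rw [this]; positivity
  have h6 : 6 * y⁻¹ ≤ 6 := by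
    rw [← div_eq_mul_inv, div_le_iff₀ (by linarith)]; linarith
  nlinarith [Real.pi_gt_three, Real.pi_pos, mul_nonneg Real.pi_pos.le hΦ]

/-! ### G. Numerical constants -/

/-- `1.7320508 ≤ √3 ≤ 1.7320509`. [folklore] -/
lemma sqrt3_bounds : (1.7320508 : ℝ) ≤ Real.sqrt 3 ∧ Real.sqrt 3 ≤ 1.7320509 := by
  constructor
  · rw [Real.le_sqrt (by norm_num) (by norm_num)]; norm_num
  · rw [Real.sqrt_le_left (by norm_num)]; norm_num

/-- `r₀ = e^{-π√3} ≤ 0.0043336`. [folklore] -/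
lemma r0_le : Real.exp (-2 * π * (Real.sqrt 3 / 2)) ≤ 0.0043336 := by
  have hp : (5.44137 : ℝ) ≤ 2 * π * (Real.sqrt 3 / 2) := by
    nlinarith [sqrt3_bounds.1, sqrt3_bounds.2, Real.pi_gt_d6, Real.pi_lt_d6]
  have hx : Real.exp 5 * Real.exp 0.44137 = Real.exp 5.44137 := by
    rw [← Real.exp_add]; norm_num
  have e5 : (2.7182818283 : ℝ) ^ 5 ≤ Real.exp 5 := by
    have := pow_le_pow_left₀ (by norm_num) Real.exp_one_gt_d9.le 5
    rw [Real.exp_one_pow] at this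
    exact_mod_cast this
  have eS : (1.55483 : ℝ) ≤ Real.exp 0.44137 := by
    have := Real.sum_le_exp_of_nonneg (show (0 : ℝ) ≤ 0.44137 by norm_num) 7
    norm_num [Finset.sum_range_succ, Nat.factorial] at this
    norm_num
    linarith
  calc Real.exp (-2 * π * (Real.sqrt 3 / 2)) ≤ Real.exp (-5.44137) :=
        Real.exp_le_exp.mpr (by linarith)
    _ = (Real.exp 5.44137)⁻¹ := Real.exp_neg _
    _ ≤ 0.0043336 := by
        rw [inv_le_comm₀ (Real.exp_pos _) (by norm_num), ← hx]
        calc ((0.0043336 : ℝ))⁻¹ ≤ 2.7182818283 ^ 5 * 1.55483 := by norm_num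
          _ ≤ Real.exp 5 * Real.exp 0.44137 :=
            mul_le_mul e5 eS (by norm_num) (Real.exp_pos _).le

/-- `0.004317 ≤ r₀ = e^{-π√3}`. [folklore] -/
lemma le_r0 : (0.004317 : ℝ) ≤ Real.exp (-2 * π * (Real.sqrt 3 / 2)) := by
  have hp : 2 * π * (Real.sqrt 3 / 2) ≤ 5.445 := by
    nlinarith [sqrt3_bounds.1, sqrt3_bounds.2, Real.pi_gt_d6, Real.pi_lt_d6]
  have e5 : Real.exp 5 ≤ (2.7182818286 : ℝ) ^ 5 := by
    have := pow_le_pow_left₀ (Real.exp_pos 1).le Real.exp_one_lt_d9.le 5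
    rw [Real.exp_one_pow] at this
    exact_mod_cast this
  have eU : Real.exp 0.445 ≤ 1.56075 := by
    have := Real.exp_bound' (show (0 : ℝ) ≤ 0.445 by norm_num) (show (0.445 : ℝ) ≤ 1 by norm_num)
      (show 0 < 4 by norm_num)
    norm_num [Finset.sum_range_succ, Nat.factorial] at this
    norm_num
    linarith
  have hprod : Real.exp 5 * Real.exp 0.445 ≤ 2.7182818286 ^ 5 * 1.56075 :=
    mul_le_mul e5 eU (Real.exp_pos _).le (by positivity)
  calc (0.004317 : ℝ) ≤ ((2.7182818286 : ℝ) ^ 5 * 1.56075)⁻¹ := by norm_num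
    _ ≤ (Real.exp 5 * Real.exp 0.445)⁻¹ := inv_anti₀ (by positivity) hprod
    _ = Real.exp (-5.445) := by rw [← Real.exp_add, ← Real.exp_neg]; norm_num
    _ ≤ Real.exp (-2 * π * (Real.sqrt 3 / 2)) := Real.exp_le_exp.mpr (by linarith)

/-- `K'' ≤ -15/8` on `[√3/2, 1]`: `-6/y² + 4π² r (24 - 144 r + 900 r²) ≤ -15/8` for
`√3/2 ≤ y ≤ 1` and `0 ≤ r ≤ 0.0043336`. [folklore] -/
lemma deriv2_le {y r : ℝ} (hy : Real.sqrt 3 / 2 ≤ y) (hy1 : y ≤ 1) (hr0 : 0 ≤ r)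
    (hrU : r ≤ 0.0043336) :
    -(6 * (y ^ 2)⁻¹) + 4 * π ^ 2 * r * (24 - 144 * r + 900 * r ^ 2) ≤ -(15 / 8) := by
  have ha0 : 0 < Real.sqrt 3 / 2 := by positivity
  have hy0 : 0 < y := ha0.trans_le hy
  have h1 : -(6 * (y ^ 2)⁻¹) ≤ -6 := by
    have : 1 ≤ (y ^ 2)⁻¹ := (one_le_inv₀ (by positivity)).mpr (by nlinarith)
    linarith
  have h2 : 24 - 144 * r + 900 * r ^ 2 ≤ 24 + 900 * 0.0043336 ^ 2 := by
    nlinarith [mul_le_mul hrU hrU hr0 (by norm_num)]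
  have h3 : r * (24 - 144 * r + 900 * r ^ 2) ≤ 0.0043336 * (24 + 900 * 0.0043336 ^ 2) :=
    mul_le_mul hrU h2 (by nlinarith [mul_le_mul hrU hrU hr0 (by norm_num)]) (by norm_num)
  have hπ : π ^ 2 ≤ 3.141593 ^ 2 := pow_le_pow_left₀ Real.pi_pos.le Real.pi_lt_d6.le 2
  have h4 : 4 * π ^ 2 * r * (24 - 144 * r + 900 * r ^ 2) ≤
      4 * 3.141593 ^ 2 * (0.0043336 * (24 + 900 * 0.0043336 ^ 2)) := by
    rw [mul_assoc]
    exact mul_le_mul (by linarith) h3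
      (by nlinarith [mul_le_mul hrU hrU hr0 (by norm_num)]) (by positivity)
  have h5 : (4 : ℝ) * 3.141593 ^ 2 * (0.0043336 * (24 + 900 * 0.0043336 ^ 2)) ≤ 4.125 := by
    norm_num
  linarith

/-- `K'(√3/2) ≤ 1/300`: `6/a - 2π - 2πΦ(r₀) ≤ 1/300` for `a ≥ 0.8660254` and
`0.004317 ≤ r₀ ≤ 0.0043336` (in truth `K'(√3/2) ≈ -1.4·10⁻⁵`: `ρ` is a critical point).
[folklore] -/
lemma deriv_at_a_le {a r₀ : ℝ} (ha : 0.8660254 ≤ a) (hrL : 0.004317 ≤ r₀) (hrU : r₀ ≤ 0.0043336) :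
    6 * a⁻¹ - 2 * π - 2 * π * (24 * r₀ - 72 * r₀ ^ 2 + 300 * r₀ ^ 3) ≤ 1 / 300 := by
  have ha0 : 0 < a := by linarith
  have h6 : 6 * a⁻¹ ≤ 6.928204 := by
    rw [← div_eq_mul_inv, div_le_iff₀ ha0]; nlinarith
  have hr0 : 0 ≤ r₀ := by linarith
  have hΦ : 24 * 0.004317 - 72 * 0.0043336 ^ 2 ≤ 24 * r₀ - 72 * r₀ ^ 2 + 300 * r₀ ^ 3 := by
    nlinarith [mul_le_mul hrU hrU hr0 (by norm_num), pow_nonneg hr0 3]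
  have hπ := Real.pi_gt_d6
  nlinarith [mul_nonneg (sub_nonneg.mpr hπ.le) (sub_nonneg.mpr hΦ), Real.pi_pos]

/-- The final numerical comparison. [folklore] -/
lemma final_numeric :
    (27 / 64 : ℝ) * 0.0043336 * Real.exp 0.10335 ≤ (14.045 / (4 * π ^ 2)) ^ 6 := by
  have hT : Real.exp 0.10335 ≤ 1.10888 := by
    have := Real.exp_bound' (show (0 : ℝ) ≤ 0.10335 by norm_num)
      (show (0.10335 : ℝ) ≤ 1 by norm_num) (show 0 < 6 by norm_num)
    norm_num [Finset.sum_range_succ, Nat.factorial] at this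
    norm_num
    linarith
  have hπle := Real.pi_lt_d6.le
  have hπ : (14.045 / (4 * (3.141593 : ℝ) ^ 2)) ^ 6 ≤ (14.045 / (4 * π ^ 2)) ^ 6 := by
    gcongr
  calc (27 / 64 : ℝ) * 0.0043336 * Real.exp 0.10335 ≤ 27 / 64 * 0.0043336 * 1.10888 := by
        gcongr
    _ ≤ (14.045 / (4 * (3.141593 : ℝ) ^ 2)) ^ 6 := by norm_num
    _ ≤ _ := hπ

/-! ### H. The main analytic inequality and the assembly -/

/-- `exp (6 log y - 2πy + P) = y⁶ · e^{-2πy} · e^P`. [folklore] -/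
lemma exp_six_log_sub_add {y : ℝ} (hy : 0 < y) (P : ℝ) :
    Real.exp (6 * Real.log y - 2 * π * y + P) =
      y ^ 6 * (Real.exp (-2 * π * y) * Real.exp P) := by
  rw [show 6 * Real.log y - 2 * π * y + P = ((6 : ℕ) : ℝ) * Real.log y + (-2 * π * y) + P by
      push_cast; ring,
    Real.exp_add, Real.exp_add, Real.exp_nat_mul, Real.exp_log hy, mul_assoc]

/-- For `Im τ ≥ √3/2`: `(Im τ)⁶ |Δ(τ)| ≤ (14.045/(4π²))⁶` (the maximum of the left side over `ℍ`
is `(√3/2)⁶|Δ(ρ)| = (14.04455…/(4π²))⁶`). The majorant used is `exp K(Im τ)` with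
`K(y) = 6 log y - 2πy + ψ(e^{-2πy})`, `ψ(r) = 24r - 36r² + 100r³`. [folklore] -/
theorem im_pow_six_mul_norm_discriminant_le (τ : ℍ) (hτ : Real.sqrt 3 / 2 ≤ τ.im) :
    τ.im ^ 6 * ‖ModularForm.discriminant τ‖ ≤ (14.045 / (4 * π ^ 2)) ^ 6 := by
  set a : ℝ := Real.sqrt 3 / 2 with ha
  have ha0 : 0 < a := by positivity
  have ha1 : a ≤ 1 := by rw [ha]; linarith [sqrt3_bounds.2]
  have ha_lb : 0.8660254 ≤ a := by rw [ha]; linarith [sqrt3_bounds.1]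
  have hy0 : 0 < τ.im := τ.im_pos
  have hrle : ∀ y, a ≤ y → Real.exp (-2 * π * y) ≤ 0.0043336 := fun y hy =>
    (Real.exp_le_exp.mpr (by nlinarith [Real.pi_pos])).trans r0_le
  set r : ℝ := Real.exp (-2 * π * τ.im) with hr
  set r₀ : ℝ := Real.exp (-2 * π * a) with hr₀
  have hrU : r₀ ≤ 0.0043336 := r0_le
  have hrL : 0.004317 ≤ r₀ := le_r0
  have hrpos : 0 < r := Real.exp_pos _
  have hr₀pos : 0 ≤ r₀ := (Real.exp_pos _).le
  have hr7 : r ≤ 1 / 7 := (hrle _ hτ).trans (by norm_num)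
  have hr25 : r ≤ 1 / 25 := (hrle _ hτ).trans (by norm_num)
  -- Step 1: `‖Δ τ‖ ≤ r · exp (ψ r)`.
  have h1 := norm_discriminant_le τ hr7
  have h2 : ((1 + r) ^ 2 * (1 - r)) ^ 24 * Real.exp (24 * (r ^ 3 / (1 - r))) ≤
      Real.exp (24 * r - 36 * r ^ 2 + 100 * r ^ 3) := by
    have hpos : 0 < (1 + r) ^ 2 * (1 - r) := mul_pos (by positivity) (by linarith)
    rw [← Real.exp_log hpos, ← Real.exp_nat_mul, ← Real.exp_add, Real.exp_le_exp,
      Real.log_mul (by positivity) (by linarith), Real.log_pow]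
    have := log_bound r hrpos.le hr25
    push_cast
    linarith
  have hΔ : ‖ModularForm.discriminant τ‖ ≤ r * Real.exp (24 * r - 36 * r ^ 2 + 100 * r ^ 3) :=
    h1.trans (mul_le_mul_of_nonneg_left h2 hrpos.le)
  -- Step 2: `K(Im τ) ≤ K(a) + ε²/(2c)` with `ε = 1/300`, `c = 15/8`.
  have hKle : 6 * Real.log τ.im - 2 * π * τ.im + (24 * r - 36 * r ^ 2 + 100 * r ^ 3) ≤
      6 * Real.log a - 2 * π * a + (24 * r₀ - 36 * r₀ ^ 2 + 100 * r₀ ^ 3) +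
        (1 / 300) ^ 2 / (2 * (15 / 8)) :=
    le_add_sq_div_of_deriv2
      (K := fun y => 6 * Real.log y - 2 * π * y + (24 * Real.exp (-2 * π * y) -
        36 * Real.exp (-2 * π * y) ^ 2 + 100 * Real.exp (-2 * π * y) ^ 3))
      (K₁ := fun y => 6 * y⁻¹ - 2 * π - 2 * π * (24 * Real.exp (-2 * π * y) -
        72 * Real.exp (-2 * π * y) ^ 2 + 300 * Real.exp (-2 * π * y) ^ 3))
      (K₂ := fun y => -(6 * (y ^ 2)⁻¹) + 4 * π ^ 2 * Real.exp (-2 * π * y) *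
        (24 - 144 * Real.exp (-2 * π * y) + 900 * Real.exp (-2 * π * y) ^ 2))
      ha0 ha1 (by norm_num)
      (fun y hy => (hasDerivAt_log_lin_comp hy (hasDerivAt_psi _)).congr_deriv (by ring))
      (fun y hy => (hasDerivAt_inv_sub_comp hy (hasDerivAt_phi _)).congr_deriv (by ring))
      (fun y hy => deriv2_le hy.1 hy.2 (Real.exp_pos _).le (hrle y hy.1))
      (deriv_at_a_le ha_lb hrL hrU)
      (fun y hy => six_div_sub_le_zero hy (Real.exp_pos _).le) hτ
  -- Step 3: `exp (K a + ε²/(2c)) ≤ (27/64) · 0.0043336 · exp 0.10335`.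
  have ha6 : a ^ 6 = 27 / 64 := by
    rw [ha, div_pow, show Real.sqrt 3 ^ 6 = (Real.sqrt 3 ^ 2) ^ 3 by ring,
      Real.sq_sqrt (by norm_num)]
    norm_num
  have hψ : 24 * r₀ - 36 * r₀ ^ 2 + 100 * r₀ ^ 3 + (1 / 300) ^ 2 / (2 * (15 / 8)) ≤ 0.10335 := by
    nlinarith [mul_le_mul hrL hrL (by norm_num) hr₀pos, pow_le_pow_left₀ hr₀pos hrU 3]
  have h3 : Real.exp (6 * Real.log a - 2 * π * a + (24 * r₀ - 36 * r₀ ^ 2 + 100 * r₀ ^ 3) +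
      (1 / 300) ^ 2 / (2 * (15 / 8))) ≤ 27 / 64 * 0.0043336 * Real.exp 0.10335 := by
    rw [add_assoc, exp_six_log_sub_add ha0, ha6]
    have e2 : r₀ * Real.exp (24 * r₀ - 36 * r₀ ^ 2 + 100 * r₀ ^ 3 +
        (1 / 300) ^ 2 / (2 * (15 / 8))) ≤ 0.0043336 * Real.exp 0.10335 :=
      mul_le_mul hrU (Real.exp_le_exp.mpr hψ) (Real.exp_pos _).le (by norm_num)
    linarith
  -- Assembly.
  calc τ.im ^ 6 * ‖ModularForm.discriminant τ‖
      ≤ τ.im ^ 6 * (r * Real.exp (24 * r - 36 * r ^ 2 + 100 * r ^ 3)) := by gcongr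
    _ = Real.exp (6 * Real.log τ.im - 2 * π * τ.im + (24 * r - 36 * r ^ 2 + 100 * r ^ 3)) :=
        (exp_six_log_sub_add hy0 _).symm
    _ ≤ Real.exp (6 * Real.log a - 2 * π * a + (24 * r₀ - 36 * r₀ ^ 2 + 100 * r₀ ^ 3) +
          (1 / 300) ^ 2 / (2 * (15 / 8))) := Real.exp_le_exp.mpr hKle
    _ ≤ 27 / 64 * 0.0043336 * Real.exp 0.10335 := h3
    _ ≤ (14.045 / (4 * π ^ 2)) ^ 6 := final_numeric

end Watkins2004

open Watkins2004 Literature.NumberTheory.EllipticCurves.ModularForms in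
/-- **Watkins (2004), Lemma 2.1** — proved: for every elliptic `W/ℚ` and every period pair `L`
spanning the period lattice of `dx/(2y + a₁x + a₃)` (`g₂(L) = c₄/12`, `g₃(L) = c₆/216`),
`covol(L) · |Δ(W)|^{1/6} ≤ 14.045`.

Watkins' printed proof computes `1/Ω` through the AGM expressions of the real and imaginary
periods (Cohen, Ch. 7) and minimises over the shape parameter. Mathlib has no period/AGM link, so
the proof here goes through the (equivalent) modular formulation: writing `L = ω(ℤτ + ℤ)` with
`τ` in the standard fundamental domain, `Δ(W) = (2π)¹² ω⁻¹² Δ(τ)` and `covol = |ω|² Im τ`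
(uniformisation, Silverman AEC VI.3.6), so `covol · |Δ(W)|^{1/6} = 4π² · Im τ · |Δ(τ)|^{1/6}`, and
`(Im τ)⁶ |Δ(τ)| ≤ (14.045/4π²)⁶` on `Im τ ≥ √3/2` is proved from the product formula
`Δ = q ∏ (1 - qⁿ)²⁴` with explicit estimates (the true maximum, at `τ = ρ`, gives `14.04455…`).
[cite: Watkins2004, Lemma 2.1] -/
theorem watkins2004_lemma_2_1_holds : watkins2004_lemma_2_1 := by
  intro W _ L hN
  obtain ⟨ω, τ, hω, hτfd, hG, hcov⟩ := periodPair_reduction L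
  have hΔ := neron_Δ_eq hN hG
  have hy : Real.sqrt 3 / 2 ≤ τ.im := by
    have h3 := ModularGroup.three_le_four_mul_im_sq_of_mem_fd hτfd
    have : Real.sqrt 3 ≤ 2 * τ.im :=
      Real.sqrt_le_iff.mpr ⟨by positivity, by nlinarith [h3]⟩
    linarith
  have hmain := im_pow_six_mul_norm_discriminant_le τ hy
  set X : ℝ := ‖ModularForm.discriminant τ‖ with hX
  have hX0 : 0 ≤ X := norm_nonneg _
  set ρ : ℝ := ‖ω‖ with hρ
  have hρ0 : 0 < ρ := norm_pos_iff.mpr hω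
  have hnormΔ : ((|W.Δ| : ℚ) : ℝ) = 4096 * π ^ 12 * (ρ ^ 12)⁻¹ * X := by
    rw [Rat.cast_abs, ← Complex.norm_ratCast, hΔ]
    simp [norm_inv, norm_pow, Complex.norm_real, abs_of_pos Real.pi_pos, hX, hρ]
  rw [hcov, hnormΔ, show (1 / 6 : ℝ) = ((6 : ℕ) : ℝ)⁻¹ by norm_num]
  have key : (4096 * π ^ 12 * (ρ ^ 12)⁻¹ * X) ^ ((6 : ℕ) : ℝ)⁻¹ =
      4 * π ^ 2 * (ρ ^ 2)⁻¹ * X ^ ((6 : ℕ) : ℝ)⁻¹ := by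
    rw [show 4096 * π ^ 12 * (ρ ^ 12)⁻¹ * X = (4 * π ^ 2 * (ρ ^ 2)⁻¹) ^ 6 * X by ring,
      Real.mul_rpow (by positivity) hX0, Real.pow_rpow_inv_natCast (by positivity) (by norm_num)]
  have h6 : τ.im * X ^ ((6 : ℕ) : ℝ)⁻¹ = (τ.im ^ 6 * X) ^ ((6 : ℕ) : ℝ)⁻¹ := by
    rw [Real.mul_rpow (by positivity) hX0, Real.pow_rpow_inv_natCast τ.im_pos.le (by norm_num)]
  have h7 : (τ.im ^ 6 * X) ^ ((6 : ℕ) : ℝ)⁻¹ ≤ 14.045 / (4 * π ^ 2) := by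
    have := Real.rpow_le_rpow (by positivity) hmain
      (by positivity : (0 : ℝ) ≤ ((6 : ℕ) : ℝ)⁻¹)
    rwa [Real.pow_rpow_inv_natCast (by positivity) (by norm_num)] at this
  calc ρ ^ 2 * τ.im * (4096 * π ^ 12 * (ρ ^ 12)⁻¹ * X) ^ ((6 : ℕ) : ℝ)⁻¹
      = 4 * π ^ 2 * (τ.im * X ^ ((6 : ℕ) : ℝ)⁻¹) := by
        rw [key]; field_simp
    _ = 4 * π ^ 2 * (τ.im ^ 6 * X) ^ ((6 : ℕ) : ℝ)⁻¹ := by rw [h6]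
    _ ≤ 4 * π ^ 2 * (14.045 / (4 * π ^ 2)) := by gcongr
    _ = 14.045 := by field_simp

end Literature.NumberTheory.EllipticCurves

end
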